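import Summits.QuantumFields.YangMills.Theorems.BalabanUVNodesN09InteriorSolvableSetOpen
import Summits.QuantumFields.YangMills.Theorems.BalabanUVNodesN09MembershipDomainDoorAtRecord

/-!
# NODE N09 — (L3) THE DOOR's ROW `hopen` FROM BERGE: the membership domain `domUOfRecord ν εbg ρ K k` IS OPEN given, at its members, N07's INTERIORITY sentence (I) for the closed-class
# minimisers and [B11] Thm 1 (6) UNIQUENESS on the open plaquette ball `PlaqSmall 2ρ` its members lie in — no Sect. G input: the ρ-MEMBERSHIP conjunct propagates by upper hemicontinuity of the
# minimiser correspondence into the OPEN target `bgReg ρ` (this seat's g6 Berge line, `Literature.Topology.eventually_minimisers_subset`), solvability by g6's (E)∧(I) propagation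

TRACK A (YM-PLAN §2d, node N09 of 28), seat `pub-ymgap-dag-n09-w1` g8, file 12 of the (G-a)∕(L) set — director-ym №320 (3)∕(4): FLAG №7′'s residue = the displayed rows `hmemχ`, `hopen`, N07's
`hres`∕`huniq`, `hind`; (L) = inhabit them.  Key of record K1⁹ stmt-QuantumFields-27364 (`--supports … --as helper`, count-neutral).  [I] = [Balaban1987RG1], [B11] = [Balaban1985Variational], [B7] =
[Balaban1985Averaging].  Imports g6 `…N09InteriorSolvableSetOpen` (⇒ `…N09SelectorContinuousOfUniqueOrbit` Berge objects, `…N09AveragingOpenAtSmallFields`) and the door at the record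
(`domUOfRecord`, `plaqSmall_two_mul_of_mem_domUOfRecord`).  THEOREMS ONLY (0 `def`, 0 `sorry`).

WHY (memo §5.2 row `hopen`; sizing (L3) I.≈31035).  The door displays `hopen : ∀ j < P.K, IsOpen (domU (j+1))` «INHABITED BY: not yet ([B11] Sect. G (U)-propagation)».  On a MEMBERSHIP family
Sect. G is not needed: (a) `domAlt` is open (dag-n09-a); (b) members have a non-empty open-class fibre ((E): `Uk V₀ ∈ bgReg εbg` averages to `V₀`), so with N07's interiority sentence (I) at members
g6's `eventually_ukExists` gives SOLVABILITY near `V₀`; (c) the ρ-MEMBERSHIP of the chosen minimiser propagates: at a member every closed-class minimiser is interior ((I)), hence a `bgReg εbg`-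
minimiser, hence ((1.1)-uniqueness at `V₀`) a residual transform of `Uk V₀ ∈ bgReg ρ`, hence in the OPEN set `bgReg ρ` (orbit-invariance) — Berge's `eventually_minimisers_subset` with target
`bgReg ρ` puts every closed-class minimiser of nearby data in `bgReg ρ`, in particular the chosen one (a `bgReg εbg`-minimiser attains the closed-class minimum once (I) holds nearby); (d) UNIQUENESS
nearby is [B11] Thm 1 (6) at the nearby data, which lie in the open ball `PlaqSmall 2ρ` the member lies in ([B7] (54): `Uk V₀ ∈ bgReg ρ ⇒ PlaqSmall 2ρ V₀`) — INNER-regular for radius `εbg` as soon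
as `B₃·2ρ ≤ εbg ≤ a₀` — DISPLAYED as `huniqIn` (N07's slot; D-defB-1 species).  So `hopen` «INHABITED BY: (I) at members (N07 direct-method row) + Thm 1 (6) on `PlaqSmall 2ρ` (N07) + THIS file».
* §1 `eventually_closureMinimisers_mem_open` — g6's `eventually_interior_of_interior` with the OPEN TARGET generalised from `bgReg e` to any open `O` containing all closed-class minimisers at `V₀`.
* §2 ★★★ `isOpen_domUOfRecord_of_interior_of_uniqIn` — the door's `hopen` row at one level, from (I) at members + `huniqIn` + g6's numerics on `εbg` (`εbg < α₀`, [B7] rows, loop guard) + the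
  [B7] rows on `ρ`; `hopen_onDomU_of_interior_of_uniqIn` — the `∀ j < P.K` family form the door consumes.
HONEST FRAMING: count-neutral kernel topology BY NAME (Berge, g6); [B11] Thm 1 NOT asserted — (I) and `huniqIn` are DISPLAYED rows (N07's); nothing of Bałaban asserted; no record core edited;
FLAG №7′ OPEN (WORK-BOUND (L): `hmemχ`∕(L2) remains); N09 ∕ N07 ∕ N24 NOT discharged; counts unmoved (typed 28∕28 · discharged 8∕28); R4 = the conditional finite-𝕋⁴ rung `BalabanLadder.UV` only;
the Yang–Mills mass gap (Clay) is NOT proved by any of this.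
-/

noncomputable section

open scoped Topology
open Set Filter

namespace Summit.QuantumFields.YangMills.BalabanUVNodes.N09MembershipDomainOpenOfBerge

open Literature.Topology (eventually_minimisers_subset)
open Literature.MathematicalPhysics.QuantumFieldTheory.Balaban1983to89
open Literature.MathematicalPhysics.QuantumFieldTheory.Balaban1983to89.T4Continuum (T4Family)
open Literature.MathematicalPhysics.QuantumFieldTheory.Balaban1983to89.ExpMeanLog (deltaSU)
open Literature.MathematicalPhysics.QuantumFieldTheory.Balaban1983to89.Node00
open Summit.QuantumFields.YangMills.BalabanUVNodes.N07DirectMethod (continuous_wilsonAction4)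
open Summit.QuantumFields.YangMills.BalabanUVNodes.N09SelectorContinuousOfUniqueOrbit
  (isCompact_closureFibre upperHemicontinuous_closureFibre isOpen_bgReg' isBackground_of_closureMinimiser isBackground_iff_minimiser)
open Summit.QuantumFields.YangMills.BalabanUVNodes.N09AveragingOpenAtSmallFields (hopen_of_plaqSmall)
open Summit.QuantumFields.YangMills.BalabanUVNodes.N09InteriorSolvableSetOpen (eventually_interior_of_interior eventually_ukExists)
open Summit.QuantumFields.YangMills.BalabanUVNodes.N09BackgroundRadiiTransfer (mem_bgReg_iff_of_orbitRel)
open Summit.QuantumFields.YangMills.BalabanUVNodes.N09MembershipDomainDoorAtRecord (plaqSmall_two_mul_of_mem_domUOfRecord)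
open B12ContinuousTransportInvarianceOn (isOpen_domAltOfRecord)

variable {F : T4Family} {N : ℕ} [NeZero N]

/-! ## §1. Berge with an arbitrary open target containing the closed-class minimisers -/

/-- **CLOSED-CLASS MINIMISERS OF NEARBY DATA STAY IN ANY OPEN SET CONTAINING THOSE AT `V₀`** (g6's `eventually_interior_of_interior` with the target generalised): if at `V₀` every minimiser of
the Wilson action over `closure (bgReg e) ∩ 𝔅_k(V₀)` is interior ((I)) AND lies in the open set `O`, then for every `V` near `V₀` every closed-class minimiser over `V` lies in `O` — Berge's upper
hemicontinuity (`eventually_minimisers_subset`) on the compact closed-class fibres, lower hemicontinuity at the (interior) minimisers being the openness of `Ū^k` (`hopen_of_plaqSmall`).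
[cite: Balaban1985Variational, Thm 1 (8) p.279, Prop. 7 p.299; Balaban1987RG1, (0.21) p.256 and (0.4) p.253] -/
theorem eventually_closureMinimisers_mem_open (K k : ℕ) {e α₀ : ℝ} (he : e < α₀) (hα : 0 < α₀)
    (hα3 : (143 * (((((F.P K).d + 4 : ℕ) : ℝ)) ^ 2 / 4) ^ 2) * α₀ ≤ 1 / 3)
    (hα2 : 2 * α₀ ≤ 2 * deltaSU (Fin N) / ((((F.P K).d + 4) * (F.P K).L : ℕ) : ℝ) ^ 2)
    (hα24 : ((((F.P K).d + 2) * (F.P K).L : ℕ) : ℝ) ^ 2 / 4 * (2 * α₀) ≤ 1 / 24)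
    (hαL : 157 * (((((F.P K).d + 2) * (F.P K).L : ℕ) : ℝ) ^ 2 / 4 * (2 * α₀)) < (((F.P K).L : ℝ) ^ ((F.P K).d - 1))⁻¹)
    (hk : k ≤ (F.P K).m + (F.P K).K) {V₀ : GaugeField (F.P K) k (SU N)}
    (hint : ∀ U₀ : GaugeField (F.P K) 0 (SU N), IsBackground (avOfRecord F N K) (closure (bgReg F N K k e)) k V₀ U₀ → U₀ ∈ bgReg F N K k e)
    {O : Set (GaugeField (F.P K) 0 (SU N))} (hO : IsOpen O)
    (hmemO : ∀ U₀ : GaugeField (F.P K) 0 (SU N), IsBackground (avOfRecord F N K) (closure (bgReg F N K k e)) k V₀ U₀ → U₀ ∈ O) :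
    ∀ᶠ V in 𝓝 V₀, ∀ U₀ : GaugeField (F.P K) 0 (SU N),
      IsBackground (avOfRecord F N K) (closure (bgReg F N K k e)) k V U₀ → U₀ ∈ O := by
  set Φ : GaugeField (F.P K) 0 (SU N) → GaugeField (F.P K) k (SU N) := Averaging.iter (avOfRecord F N K) k with hΦ
  set Γ : GaugeField (F.P K) k (SU N) → Set (GaugeField (F.P K) 0 (SU N)) := fun V => closure (bgReg F N K k e) ∩ Φ ⁻¹' {V} with hΓ
  have hFc : ∀ U ∈ Γ V₀, ContinuousAt (fun p : GaugeField (F.P K) k (SU N) × GaugeField (F.P K) 0 (SU N) => wilsonAction4 p.2) (V₀, U) :=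
    fun _ _ => (continuous_wilsonAction4.comp continuous_snd).continuousAt
  have hΓc : IsCompact (Γ V₀) := isCompact_closureFibre K k he hα hα3 hα2 V₀
  have hup : UpperHemicontinuousWithinAt Γ univ V₀ :=
    fun t ht => ((upperHemicontinuous_closureFibre K k he hα hα3 hα2) V₀ t ht).filter_mono nhdsWithin_le_nhds
  have hlow : ∀ U ∈ Γ V₀, IsMinOn (fun U => wilsonAction4 U) (Γ V₀) U →
      ∀ u : Set (GaugeField (F.P K) 0 (SU N)), IsOpen u → U ∈ u → ∀ᶠ V in 𝓝[univ] V₀, (Γ V ∩ u).Nonempty := by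
    intro U hU hmin u hu hUu
    have hbg : IsBackground (avOfRecord F N K) (bgReg F N K k e) k V₀ U := isBackground_of_closureMinimiser hint hU hmin
    have hOu : u ∩ bgReg F N K k e ∈ 𝓝 U := (hu.inter (isOpen_bgReg' K k e)).mem_nhds ⟨hUu, hbg.2.1⟩
    filter_upwards [hopen_of_plaqSmall K k he hα hα3 hα2 hα24 hαL hk univ hbg _ hOu] with V hV
    obtain ⟨U', ⟨hU'u, hU'bg⟩, hU'V⟩ := hV
    exact ⟨U', ⟨subset_closure hU'bg, hU'V⟩, hU'u⟩
  have hsub : ∀ U ∈ Γ V₀, IsMinOn (fun U => wilsonAction4 U) (Γ V₀) U → U ∈ O :=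
    fun U hU hmin => hmemO U (isBackground_iff_minimiser.2 ⟨hU, hmin⟩)
  have h := eventually_minimisers_subset (F := fun p : GaugeField (F.P K) k (SU N) × GaugeField (F.P K) 0 (SU N) => wilsonAction4 p.2)
    (Γ := Γ) hFc hΓc hup hlow hO hsub
  rw [nhdsWithin_univ] at h
  filter_upwards [h] with V hV U₀ h₀
  exact hV U₀ (isBackground_iff_minimiser.1 h₀).1 (isBackground_iff_minimiser.1 h₀).2

/-! ## §2. The membership domain is open, given interiority at members and uniqueness on the plaquette ball its members lie in -/

/-- ★★★ **THE DOOR's ROW `hopen` AT ONE LEVEL**: the membership domain `domUOfRecord ν εbg ρ K k` is OPEN, given — at every MEMBER — N07's interiority sentence (I) («every minimiser over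
`closure (bgReg εbg) ∩ 𝔅_k(V)` lies in `bgReg εbg`», `hint`) and — on the open plaquette ball `PlaqSmall (2ρ)` the members lie in ([B7] (54)) — [B11] Thm 1 (6) uniqueness at radius `εbg`
(`huniqIn`; inside Thm 1's window iff `2B₃ρ ≤ εbg ≤ a₀`); numerics: g6's admissibility of `εbg` (`εbg < α₀`, [B7] rows on `α₀`, loop guard) and the [B7] rows on `ρ`.  Conjunct by conjunct near a
member `V₀`: `domAlt` open; solvability by g6's `eventually_ukExists` ((E) from `Uk V₀`); uniqueness by `huniqIn` on the open ball; ρ-membership by §1 with `O := bgReg ρ` (every closed-class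
minimiser at `V₀` is a residual transform of `Uk V₀ ∈ bgReg ρ`) applied to the chosen minimiser of the nearby datum (a `bgReg εbg`-minimiser attains the closed-class minimum once (I) holds there).
CONDITIONAL on the two displayed rows; nothing of Bałaban asserted. [cite: Balaban1985Variational, Thm 1 (6), (8) p.279, Prop. 7 p.299; Balaban1987RG1, (1.1)–(1.2) p.260, p.259 and (0.21) p.256; Balaban1985Averaging, Prop. 2 (53)–(54) p.26] -/
theorem isOpen_domUOfRecord_of_interior_of_uniqIn (ν : Stage7Numerics) (K k : ℕ) {εbg ρ α₀ : ℝ} (he : εbg < α₀) (hα : 0 < α₀)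
    (hα3 : (143 * (((((F.P K).d + 4 : ℕ) : ℝ)) ^ 2 / 4) ^ 2) * α₀ ≤ 1 / 3)
    (hα2 : 2 * α₀ ≤ 2 * deltaSU (Fin N) / ((((F.P K).d + 4) * (F.P K).L : ℕ) : ℝ) ^ 2)
    (hα24 : ((((F.P K).d + 2) * (F.P K).L : ℕ) : ℝ) ^ 2 / 4 * (2 * α₀) ≤ 1 / 24)
    (hαL : 157 * (((((F.P K).d + 2) * (F.P K).L : ℕ) : ℝ) ^ 2 / 4 * (2 * α₀)) < (((F.P K).L : ℝ) ^ ((F.P K).d - 1))⁻¹)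
    (hk : k ≤ (F.P K).m + (F.P K).K) (hρ : 0 < ρ)
    (hρ3 : (143 * (((((F.P K).d + 4 : ℕ) : ℝ)) ^ 2 / 4) ^ 2) * ρ ≤ 1 / 3)
    (hρ2 : 2 * ρ ≤ 2 * deltaSU (Fin N) / ((((F.P K).d + 4) * (F.P K).L : ℕ) : ℝ) ^ 2)
    (hint : ∀ V ∈ domUOfRecord F N ν εbg ρ K k, ∀ U₀ : GaugeField (F.P K) 0 (SU N),
      IsBackground (avOfRecord F N K) (closure (bgReg F N K k εbg)) k V U₀ → U₀ ∈ bgReg F N K k εbg)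
    (huniqIn : ∀ V : GaugeField (F.P K) k (SU N), PlaqSmall (2 * ρ) V → UniqueUkOrbit F N K k εbg V) :
    IsOpen (domUOfRecord F N ν εbg ρ K k) := by
  rw [isOpen_iff_eventually]
  intro V₀ hV₀
  obtain ⟨hA₀, hex₀, hun₀, hmem₀⟩ := (mem_domUOfRecord_iff ν εbg ρ K k V₀).1 hV₀
  have hI₀ := hint V₀ hV₀
  have hne₀ : ∃ U ∈ bgReg F N K k εbg, Averaging.iter (avOfRecord F N K) k U = V₀ := ⟨_, Uk_mem_bgReg hex₀, iter_Uk hex₀⟩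
  -- every closed-class minimiser at V₀ is a residual transform of `Uk V₀`, hence in the open set `bgReg ρ`
  have hmemO : ∀ U₀ : GaugeField (F.P K) 0 (SU N), IsBackground (avOfRecord F N K) (closure (bgReg F N K k εbg)) k V₀ U₀ → U₀ ∈ bgReg F N K k ρ := by
    intro U₀ h₀
    obtain ⟨hU₀, hmin⟩ := isBackground_iff_minimiser.1 h₀
    have hbg : IsBackground (avOfRecord F N K) (bgReg F N K k εbg) k V₀ U₀ := isBackground_of_closureMinimiser hI₀ hU₀ hmin
    exact (mem_bgReg_iff_of_orbitRel (hun₀ _ _ (isBackground_Uk hex₀) hbg)).1 hmem₀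
  -- the four conjuncts propagate
  have h2ρ : PlaqSmall (2 * ρ) V₀ := plaqSmall_two_mul_of_mem_domUOfRecord ν hρ hρ3 hρ2 hV₀
  have hball : ∀ᶠ V in 𝓝 V₀, PlaqSmall (2 * ρ) V := (Node00.isOpen_plaqSmall (P := F.P K) (j := k) (N := N) (2 * ρ)).mem_nhds h2ρ
  have hAlt : ∀ᶠ V in 𝓝 V₀, V ∈ domAltOfRecord F N ν K k := (isOpen_domAltOfRecord ν K k).mem_nhds hA₀
  filter_upwards [hAlt, hball, eventually_ukExists K k he hα hα3 hα2 hα24 hαL hk hne₀ hI₀,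
    eventually_interior_of_interior K k he hα hα3 hα2 hα24 hαL hk hI₀,
    eventually_closureMinimisers_mem_open K k he hα hα3 hα2 hα24 hαL hk hI₀ (isOpen_bgReg' K k ρ) hmemO] with V hA hb hex hI hO
  refine (mem_domUOfRecord_iff ν εbg ρ K k V).2 ⟨hA, hex, huniqIn V hb, ?_⟩
  -- the chosen minimiser of V attains the closed-class minimum (by (I) at V), so it lies in `bgReg ρ`
  refine hO _ (isBackground_iff_minimiser.2 ⟨⟨subset_closure (Uk_mem_bgReg hex), iter_Uk hex⟩, fun U hU => ?_⟩)
  -- minimality over the closed-class fibre: compare with a closed-class minimiser, which is interior by (I)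
  obtain ⟨U₁, hU₁, hmin₁⟩ := (isCompact_closureFibre K k he hα hα3 hα2 V).exists_isMinOn ⟨_, subset_closure (Uk_mem_bgReg hex), iter_Uk hex⟩
    (continuous_wilsonAction4.continuousOn)
  have hbg₁ : IsBackground (avOfRecord F N K) (bgReg F N K k εbg) k V U₁ := isBackground_of_closureMinimiser hI hU₁ hmin₁
  exact ((isBackground_Uk hex).2.2 U₁ hbg₁.2.1 hbg₁.1).trans (hmin₁ hU)

/-- **THE DOOR's `hopen` ROW, FAMILY FORM** (`∀ j < P.K, IsOpen (domU (j+1))`) from the per-level theorem: interiority at members and uniqueness on `PlaqSmall 2ρ` displayed per level; the numerics on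
`εbg` and `ρ` as in g6 ∕ the door. [cite: Balaban1985Variational, Thm 1 (6), (8) p.279; Balaban1987RG1, p.259 and (1.1) p.260] -/
theorem hopen_onDomU_of_interior_of_uniqIn (ν : Stage7Numerics) (P : B12.RunParams) {εbg ρ α₀ : ℝ} (he : εbg < α₀) (hα : 0 < α₀)
    (hα3 : (143 * (((((F.P P.K).d + 4 : ℕ) : ℝ)) ^ 2 / 4) ^ 2) * α₀ ≤ 1 / 3)
    (hα2 : 2 * α₀ ≤ 2 * deltaSU (Fin N) / ((((F.P P.K).d + 4) * (F.P P.K).L : ℕ) : ℝ) ^ 2)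
    (hα24 : ((((F.P P.K).d + 2) * (F.P P.K).L : ℕ) : ℝ) ^ 2 / 4 * (2 * α₀) ≤ 1 / 24)
    (hαL : 157 * (((((F.P P.K).d + 2) * (F.P P.K).L : ℕ) : ℝ) ^ 2 / 4 * (2 * α₀)) < (((F.P P.K).L : ℝ) ^ ((F.P P.K).d - 1))⁻¹)
    (hρ : 0 < ρ) (hρ3 : (143 * (((((F.P P.K).d + 4 : ℕ) : ℝ)) ^ 2 / 4) ^ 2) * ρ ≤ 1 / 3)
    (hρ2 : 2 * ρ ≤ 2 * deltaSU (Fin N) / ((((F.P P.K).d + 4) * (F.P P.K).L : ℕ) : ℝ) ^ 2)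
    (hint : ∀ j < P.K, ∀ V ∈ domUOfRecord F N ν εbg ρ P.K (j + 1), ∀ U₀ : GaugeField (F.P P.K) 0 (SU N),
      IsBackground (avOfRecord F N P.K) (closure (bgReg F N P.K (j + 1) εbg)) (j + 1) V U₀ → U₀ ∈ bgReg F N P.K (j + 1) εbg)
    (huniqIn : ∀ j < P.K, ∀ V : GaugeField (F.P P.K) (j + 1) (SU N), PlaqSmall (2 * ρ) V → UniqueUkOrbit F N P.K (j + 1) εbg V) :
    ∀ j < P.K, IsOpen (X := PBond (F.P P.K) (j + 1) → SU N) (domUOfRecord F N ν εbg ρ P.K (j + 1)) :=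
  fun j hj => isOpen_domUOfRecord_of_interior_of_uniqIn ν P.K (j + 1) he hα hα3 hα2 hα24 hαL
    (by simp only [T4Continuum.T4Family.P_K, T4Continuum.T4Family.P_m]; omega) hρ hρ3 hρ2 (hint j hj) (huniqIn j hj)

end Summit.QuantumFields.YangMills.BalabanUVNodes.N09MembershipDomainOpenOfBerge

end
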